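import Summits.QuantumFields.BalabanUV.T4Continuum.Support.NE7CurvedSupLetterBootstrap
import Summits.QuantumFields.BalabanUV.T4Continuum.Support.NE7FlatGradientLetterLogCurlClosed
import Summits.QuantumFields.BalabanUV.T4Continuum.Support.NE7GaugedGradientNearFlat
import Summits.QuantumFields.BalabanUV.T4Continuum.Support.NE7FlatCurvedPointwise
import Summits.QuantumFields.BalabanUV.T4Continuum.Support.NE7CutoffLeibniz
import Summits.QuantumFields.BalabanUV.T4Continuum.Spine.NE3.SlicePoincareSlicB8Gauge
import HarnessLib

/-!
# NE7CurvedGradLetter — supplier stub (S-d′) (ROAD-G107 §4, §6): THE CURVED C¹ LETTER WITH LOGARITHM, POINTWISE — for `Y ∈ 𝒯_E(W)` (`W` unitary, multi-level small-field,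
# `SmallField W x`), `B ≥ sup‖curl_W Y‖` (`B > 0`), `S ≥ sup‖Y‖`, at EVERY bond `(y₀; μ₀, κ₀)` and every cut-off scale `K_b ≥ 1`:
# `‖Ad_{W(y₀+e_κ₀,μ₀)} Y(y₀+e_μ₀,κ₀) − Y(y₀,κ₀)‖ ≤ 2δS + g₁S + K·[(B + 16δS + 2g₁S)·(1 + log⁺(2P)) + (1 + log P)·(G + 2(d+1)δS + (d+1)g₁S)]`
# (`P = M(2K_b+12)`, `M = L^{k+1}`, `δ = (d+1)·2MC₃·x` the comb flatness, `g₁ = 1∕(MK_b)`, `G = 2(2(d+1) + 4(d+1)d·M²x)·S∕M` the divergence size) — NO BOOTSTRAP: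
# the flat C¹ letter in LOG-INTERPOLATED form (row NE7b's `NE7FlatGradientLetterLogCurlClosed.gradient_letter_box_logCurl`, with `B′ := 2B_Z`, `s := 0`, `g := flatDiv Z`)
# charges only SUP data, so the unknown gradient never appears on the right

Cell `pub-balaban`, rung (B)+1 sub-cell t4, lineage `b2b-balaban-t4-ne7-p1`, generation 107 (CRUX PROVER NE7 #1 = OWNER of BINDER row NE7).
Memo `t4/b2b-balaban-t4-ne7-p1-g107/ROAD-G107.md` §4 (S-d′), §6; the objects and the near-flatness∕cut-off∕curl-datum steps are gen 101's `NE7CurvedSupLetterBootstrap.bootstrap_at_point`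
VERBATIM (comb `u = btree M W (blk_M y₀ − C₃𝟙)`, `χ = chi 0 (MK_b) y₀`, `Z = χ•Y^{u}`).
WHY THIS IS ENOUGH (§4).  With the sup letter (L) `S ≤ 2K·M·B` (gen 101 `NE7CurvedSupLetter`), `M²x ≤ ε₀` (so `δS = O(K_bε₀)·B`, `G = O(KB)`, `g₁S ≤ 2KB∕K_b`) and `K_b = 1`:
`sup‖∇_W Y‖ ≤ K_G·(1 + log M)·B` — the C¹ slice letter WITH the junction logarithm of ROAD-G107 §2, which the θ-slack of (E) + (S-b) absorbs (`NE7EtaLogSlack`).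
WHAT ([folklore]; 0 def, 0 sorry; dimension `d + 1 ≥ 3`, `L ≥ 2`, every `k`, every `N ≥ 1`).  **`grad_letter_at_point`** (`K ≥ 0` existential = row NE7b's box constant).
HONEST FRAMING (page 1): a linear a-priori estimate on OUR typed slice assembled BY NAME over landed kernel theorems (gen 101's bootstrap data, row NE7b's flat C¹ stock, this gen's
gauged-gradient exchange); nothing of Bałaban's asserted; NOT the supplier's assembly (S-g′) (the pair's `X_N`, the rate currency), NOT NE7; spine 0∕9; finite T⁴ rung (B)+1 — NOT infinite
volume, NOT mass gap, NOT BetaPertH, NOT Clay.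
-/

set_option autoImplicit false

open scoped BigOperators Matrix.Norms.L2Operator
open Finset

namespace Summit.QuantumFields.BalabanUV.T4Continuum.NE7CurvedGradLetter

open Literature.MathematicalPhysics.QuantumFieldTheory.Balaban1983to89
open B7Prop1Explicit B7Prop2Explicit
open T4AveragingDeficitWall (IsUnitaryCfg IsSkewDir SmallField Ad curlAt box)
open T4AveragingDeficitWallBoundary (IsPeriodicCfg periodBox)
open AveragingDeficitPeriodicCounting (IsPeriodicDir)
open AveragingDeficitCounting (mem_box_iff self_mem_box)
open AveragingDeficitTransport (norm_Ad_of_unitary)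
open AveragingDeficitMultiLevelPrep (LevelSmall tower)
open AveragingDeficitTwoLevelPrep (prop1Radius)
open AveragingDeficitLocality (dirGauge)
open AveragingDeficitBlockDensity (btree btree_mem)
open AveragingDeficitLatticeH2Prep (chi chi_nonneg chi_le_one chi_eq_one_of_mem chi_eq_zero_of_not_mem abs_chi_sub_chi_le_of_step)
open SpreadLift (loopRad)
open BlockAverageVaryHolo (nbRad)
open BlockAveragePushDirSplit (flat)
open NE3CoercivityScaling (flatDiv)
open NE3CovariantWeitzenbock (covDiv)
open SmoothRefineBlocks (blk)
open NE7MeanZeroGaugeSliceW (energyBlockLandauW)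
open NE7EnergySliceDivergenceSup (divergence_sup_le)
open NE7LocalStraightDatumLetter (norm_dirGauge_le)
open NE7CurvedSupLetterData (comb_near_flat curl_datum support_of_cutoff)
open NE7FlatGradientLetterLogCurlClosed (gradient_letter_box_logCurl)
open NE7GaugedGradientNearFlat (norm_covDiff_le_fdiff_dirGauge)
open NE7FlatCurvedPointwise (norm_covDiv_sub_flatDiv_le)
open NE7CutoffLeibniz (norm_flatDiv_smul_fun_sub_le)
open NE3.SlicePoincareSlicB8Gauge (covDiv_gaugeAct)

noncomputable section

variable {d : ℕ} {n : Type*} [Fintype n] [DecidableEq n]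

set_option maxHeartbeats 800000 in
/-- **THE CURVED C¹ LETTER WITH LOGARITHM, AT A POINT** — statement in the file header. [folklore] -/
theorem grad_letter_at_point [Nonempty n] (hd : 2 ≤ d) :
    ∃ K : ℝ, 0 ≤ K ∧ ∀ {L : ℕ}, 2 ≤ L → ∀ (k N : ℕ) [NeZero N] (W : Site (d + 1) → Fin (d + 1) → (Matrix n n ℂ)ˣ) (x : ℝ),
      IsUnitaryCfg W → IsPeriodicCfg W ((tower L N (k + 1) : ℕ) : ℤ) → 0 ≤ x → LevelSmall (d + 1) L k x → SmallField W x →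
      ∀ Y ∈ energyBlockLandauW (d := d + 1) (n := n) L N (k + 1) W, ∀ (B : ℝ), 0 < B →
        (∀ (z : Site (d + 1)) (μ ν : Fin (d + 1)), μ ≠ ν → ‖curlAt W Y z μ ν‖ ≤ B) →
      ∀ (S : ℝ), 0 ≤ S → (∀ w μ, ‖Y w μ‖ ≤ S) → ∀ (y₀ : Site (d + 1)) (μ₀ κ₀ : Fin (d + 1)) (Kb C₃ : ℕ), 1 ≤ Kb → C₃ = Kb + nbRad (d + 1) L + 3 →
      ∀ (δs g₁ G : ℝ), δs = (((d + 1 : ℕ) : ℝ) * ((((2 * (L ^ (k + 1) * C₃) + 1 : ℕ) : ℝ)) - 1)) * x → g₁ = 1 / ((L ^ (k + 1) * Kb : ℕ) : ℝ) →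
      G = 2 * (2 * ((d + 1 : ℕ) : ℝ) + 4 * ((d + 1 : ℕ) : ℝ) * ((((d + 1 : ℕ) : ℝ)) - 1) * (((L : ℝ) ^ (k + 1)) ^ 2 * x)) * S / (L : ℝ) ^ (k + 1) →
      4 * (((d + 1 : ℕ) : ℝ)) ^ 2 * ((L : ℝ) ^ (k + 1) - 1) ^ 2 * x + 16 * ((d + 1 : ℕ) : ℝ) * loopRad (d + 1) L ((prop1Radius (d + 1) L)^[k] x) ≤ 1 / 2 →
      ‖Ad (W (y₀ + e κ₀) μ₀) (Y (y₀ + e μ₀) κ₀) - Y y₀ κ₀‖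
        ≤ 2 * δs * S + g₁ * S
          + K * ((B + 16 * δs * S + 2 * g₁ * S) * (1 + Real.posLog (2 * ((L : ℝ) ^ (k + 1) * ((2 * Kb + 12 : ℕ) : ℝ))))
            + (1 + Real.log ((L : ℝ) ^ (k + 1) * ((2 * Kb + 12 : ℕ) : ℝ))) * (G + ((d + 1 : ℕ) : ℝ) * (2 * δs * S) + ((d + 1 : ℕ) : ℝ) * g₁ * S)) := by
  obtain ⟨K, hK, hflat⟩ := gradient_letter_box_logCurl (d := d) (n := n) hd
  refine ⟨K, hK, ?_⟩
  intro L hL k N _ W x hWu hWP hx hs hWx Y hY B hBpos hB S hS0 hS y₀ μ₀ κ₀ Kb C₃ hKb1 hC₃ δs g₁ G hδs hg₁ hGdef hθ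
  have hL1 : 1 ≤ L := by omega
  haveI : NeZero L := ⟨by omega⟩
  have hB0 : 0 ≤ B := hBpos.le
  have hM1 : 1 ≤ L ^ (k + 1) := Nat.one_le_pow _ _ hL1
  have hMz1 : (1 : ℤ) ≤ ((L ^ (k + 1) : ℕ) : ℤ) := by exact_mod_cast hM1
  -- the objects
  obtain ⟨u, hu⟩ : ∃ u : Site (d + 1) → (Matrix n n ℂ)ˣ, u = btree (L ^ (k + 1)) W (fun i => blk (L ^ (k + 1)) y₀ i - (C₃ : ℤ)) := ⟨_, rfl⟩
  have huu : ∀ w, u w ∈ unitaryUnits (Matrix n n ℂ) := fun w => by rw [hu]; exact btree_mem hWu _ _ w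
  obtain ⟨χ, hχ⟩ : ∃ χ : Site (d + 1) → ℝ, χ = chi 0 (L ^ (k + 1) * Kb) y₀ := ⟨_, rfl⟩
  have hS' : ∀ w μ, ‖dirGauge u Y w μ‖ ≤ S := fun w μ => norm_dirGauge_le huu Y hS w μ
  -- the cut-off: values in `[0,1]`, `χ(y₀) = 1`, support, Lipschitz
  have hMKb1 : 1 ≤ L ^ (k + 1) * Kb := Nat.mul_pos (by omega) (by omega)
  have hχ1 : ∀ w, |χ w| ≤ 1 := fun w => by
    rw [hχ, abs_le]; exact ⟨by linarith only [chi_nonneg 0 (L ^ (k + 1) * Kb) y₀ w], chi_le_one _ _ _ _⟩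
  have hχy₀ : χ y₀ = 1 := by rw [hχ]; exact chi_eq_one_of_mem (self_mem_box 0 y₀)
  have hg₁0 : 0 ≤ g₁ := by rw [hg₁]; positivity
  have hstep : ∀ x₁ x₂ : Site (d + 1), (∀ j, |x₂ j - x₁ j| ≤ 1) → |χ x₂ - χ x₁| ≤ g₁ := fun x₁ x₂ h => by
    rw [hχ, hg₁]; exact abs_chi_sub_chi_le_of_step hMKb1 h
  have hMKbz : ((L ^ (k + 1) * Kb : ℕ) : ℤ) = ((L ^ (k + 1) : ℕ) : ℤ) * Kb := by push_cast; ring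
  have hsuppχ : ∀ w, χ w ≠ 0 → ∀ i, |w i - y₀ i| ≤ ((L ^ (k + 1) : ℕ) : ℤ) * Kb := by
    intro w hw
    by_contra hc
    push Not at hc
    obtain ⟨i, hi⟩ := hc
    apply hw
    rw [hχ]
    refine chi_eq_zero_of_not_mem hMKb1 (fun hmem => ?_)
    rw [zero_add] at hmem
    have := (mem_box_iff.mp hmem) i
    rw [hMKbz] at this
    linarith only [this, hi]
  -- THE NEAR-FLATNESS OF THE COMB GAUGE within sup-distance 1 of the support of `χ`
  have hδs0 : 0 ≤ δs := by
    rw [hδs]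
    refine mul_nonneg (mul_nonneg (by positivity) ?_) hx
    have : (1 : ℝ) ≤ (((2 * (L ^ (k + 1) * C₃) + 1 : ℕ)) : ℝ) := by exact_mod_cast (by omega : 1 ≤ 2 * (L ^ (k + 1) * C₃) + 1)
    linarith
  have hMnb : (0 : ℤ) ≤ ((L ^ (k + 1) : ℕ) : ℤ) * (nbRad (d + 1) L) := by positivity
  have hnear1 : ∀ z : Site (d + 1), χ z ≠ 0 → ∀ w : Site (d + 1), (∀ i, |w i - z i| ≤ 1) →
      ∀ ν, ‖((gaugeAct u W w ν : (Matrix n n ℂ)ˣ) : Matrix n n ℂ) - 1‖ ≤ δs := by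
    intro z hz w hw ν
    rw [hu, hδs]
    refine comb_near_flat hM1 hWu hx hWx y₀ Kb (nbRad (d + 1) L) C₃ hC₃ w 1 (fun i => ?_) (by linarith only [hMz1, hMnb]) ν
    have a := abs_le.mp (hsuppχ z hz i); have b := abs_le.mp (hw i)
    rw [abs_le]; constructor <;> linarith only [a.1, a.2, b.1, b.2]
  have hWq : ∀ xp : Site (d + 1), χ xp ≠ 0 → ∀ μ, ‖((gaugeAct u W xp μ : (Matrix n n ℂ)ˣ) : Matrix n n ℂ) - 1‖ ≤ δs :=
    fun xp hxp μ => hnear1 xp hxp xp (fun i => by simp) μ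
  -- THE DIVERGENCE IS `O(S∕M)`
  obtain ⟨-, hGc⟩ := divergence_sup_le (d := d + 1) (by omega) hL k hWu hWP hx hs hWx hθ hY hS
  have hGc' : ∀ w, ‖covDiv W Y w‖ ≤ G := fun w => by rw [hGdef]; exact hGc w
  have hG0 : 0 ≤ G := (norm_nonneg _).trans (hGc' 0)
  -- THE CUT-OFF FIELD AND ITS TWO SUP DATA
  set Z : Site (d + 1) → Fin (d + 1) → Matrix n n ℂ := fun w μ' => χ w • dirGauge u Y w μ' with hZ
  have hcurlZ : ∀ (z : Site (d + 1)) (μ ν : Fin (d + 1)), μ ≠ ν → ‖curlAt (flat (d := d + 1) (n := n)) Z z μ ν‖ ≤ B + 16 * δs * S + 2 * g₁ * S :=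
    fun z μ ν hne => curl_datum hWu huu Y χ hB0 hS0 hδs0 hB hS' hχ1 hstep hnear1 z μ ν hne
  set BZ : ℝ := B + 16 * δs * S + 2 * g₁ * S with hBZ
  have hBZpos : 0 < BZ := by rw [hBZ]; nlinarith only [hBpos, hδs0, hS0, hg₁0]
  have hcurlZ' : ∀ (z : Site (d + 1)) (lam μ ν : Fin (d + 1)), μ ≠ ν →
      ‖curlAt (flat (d := d + 1) (n := n)) Z (z + e lam) μ ν - curlAt (flat (d := d + 1) (n := n)) Z z μ ν‖ ≤ 2 * BZ := fun z lam μ ν hne =>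
    (norm_sub_le _ _).trans (by linarith only [hcurlZ (z + e lam) μ ν hne, hcurlZ z μ ν hne])
  set Gb : ℝ := G + ((d + 1 : ℕ) : ℝ) * (2 * δs * S) + ((d + 1 : ℕ) : ℝ) * g₁ * S with hGb
  have hdivZ : ∀ xq : Site (d + 1), ‖flatDiv Z xq‖ ≤ Gb := by
    intro xq
    have hR := norm_flatDiv_smul_fun_sub_le χ (dirGauge u Y) xq (g := g₁) (S := S)
      (fun μ => hstep (xq - e μ) xq (fun j => by simp only [Pi.sub_apply, e_apply]; split_ifs <;> simp)) (fun μ => hS' _ _)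
    have hmain : ‖χ xq • flatDiv (dirGauge u Y) xq‖ ≤ G + ((d + 1 : ℕ) : ℝ) * (2 * δs * S) := by
      by_cases hχq : χ xq = 0
      · rw [hχq, zero_smul, norm_zero]; positivity
      · rw [norm_smul, Real.norm_eq_abs]
        have hV : IsUnitaryCfg (gaugeAct u W) := fun y κ =>
          (unitaryUnits _).mul_mem ((unitaryUnits _).mul_mem (huu _) (hWu _ _)) ((unitaryUnits _).inv_mem (huu _))
        have hdef := norm_covDiv_sub_flatDiv_le hV (dirGauge u Y) xq (hWq xq hχq) (fun μ => hS' xq μ)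
        have hcov : ‖covDiv (gaugeAct u W) (dirGauge u Y) xq‖ ≤ G := by rw [covDiv_gaugeAct, norm_Ad_of_unitary (huu _)]; exact hGc' xq
        have hfl : ‖flatDiv (dirGauge u Y) xq‖ ≤ G + ((d + 1 : ℕ) : ℝ) * (2 * δs * S) := by
          have e1 : flatDiv (dirGauge u Y) xq = covDiv (gaugeAct u W) (dirGauge u Y) xq - (covDiv (gaugeAct u W) (dirGauge u Y) xq - flatDiv (dirGauge u Y) xq) := by abel
          rw [e1]; exact (norm_sub_le _ _).trans (add_le_add hcov hdef)
        have h0 : 0 ≤ ‖flatDiv (dirGauge u Y) xq‖ := norm_nonneg _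
        calc |χ xq| * ‖flatDiv (dirGauge u Y) xq‖ ≤ 1 * ‖flatDiv (dirGauge u Y) xq‖ := mul_le_mul_of_nonneg_right (hχ1 xq) h0
          _ ≤ _ := by rw [one_mul]; exact hfl
    have e2 : flatDiv Z xq = (flatDiv Z xq - χ xq • flatDiv (dirGauge u Y) xq) + χ xq • flatDiv (dirGauge u Y) xq := by abel
    rw [e2]
    calc _ ≤ ‖flatDiv Z xq - χ xq • flatDiv (dirGauge u Y) xq‖ + ‖χ xq • flatDiv (dirGauge u Y) xq‖ := norm_add_le _ _
      _ ≤ ((d + 1 : ℕ) : ℝ) * g₁ * S + (G + ((d + 1 : ℕ) : ℝ) * (2 * δs * S)) := add_le_add (by exact_mod_cast hR) hmain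
      _ = Gb := by rw [hGb]; ring
  -- THE SUPPORTS: `Z` vanishes off the big box `M•c′ + [0, M N′)`, `flatDiv Z` off its one-site enlargement (`c′ = blk y₀ − (K_b+6)𝟙`, `N′ = 2K_b + 12`)
  set c' : Site (d + 1) := fun i => blk (L ^ (k + 1)) y₀ i - ((Kb + 6 : ℕ) : ℤ) with hc'
  have hZin : ∀ xp : Site (d + 1), (∃ i, ¬ (((L ^ (k + 1) : ℕ) : ℤ) * c' i + 4 * ((L ^ (k + 1) : ℕ) : ℤ) ≤ xp i ∧
      xp i < ((L ^ (k + 1) : ℕ) : ℤ) * c' i + ((L ^ (k + 1) : ℕ) : ℤ) * ((2 * Kb + 12 : ℕ) : ℤ) - 4 * ((L ^ (k + 1) : ℕ) : ℤ))) → Z xp = 0 := by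
    intro xp hxp
    rw [hZ, hχ]
    exact support_of_cutoff hM1 hKb1 y₀ (dirGauge u Y) xp hxp
  have hZsupp : ∀ xp : Site (d + 1), (∃ i, ¬ (((L ^ (k + 1) : ℕ) : ℤ) * c' i ≤ xp i ∧
      xp i < ((L ^ (k + 1) : ℕ) : ℤ) * c' i + ((L ^ (k + 1) : ℕ) : ℤ) * ((2 * Kb + 12 : ℕ) : ℤ))) → Z xp = 0 := by
    intro xp ⟨i, hi⟩
    refine hZin xp ⟨i, fun h => hi ⟨?_, ?_⟩⟩ <;> nlinarith only [h.1, h.2, hMz1]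
  have hgsupp : ∀ xp : Site (d + 1), (∃ i, ¬ (((L ^ (k + 1) : ℕ) : ℤ) * c' i - 1 ≤ xp i ∧
      xp i ≤ ((L ^ (k + 1) : ℕ) : ℤ) * c' i + ((L ^ (k + 1) : ℕ) : ℤ) * ((2 * Kb + 12 : ℕ) : ℤ))) → flatDiv Z xp = 0 := by
    intro xp ⟨i, hi⟩
    have h1 : Z xp = 0 := hZin xp ⟨i, fun h => hi ⟨by linarith only [h.1, hMz1], by linarith only [h.2, hMz1]⟩⟩
    have h2 : ∀ μ : Fin (d + 1), Z (xp - e μ) = 0 := fun μ =>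
      hZin (xp - e μ) ⟨i, fun h => hi ⟨?_, ?_⟩⟩
    · unfold flatDiv
      exact sum_eq_zero fun μ _ => by rw [h1, h2 μ]; simp
    all_goals
      have hei : (xp - e μ) i = xp i - (if i = μ then 1 else 0) := by simp only [Pi.sub_apply, e_apply]
      rw [hei] at h
      split_ifs at h with hiμ <;> nlinarith only [h.1, h.2, hMz1]
  -- ROW NE7b's FLAT C¹ LETTER (log-interpolated curl datum, `B′ := 2B_Z`, `s := 0`, `g := flatDiv Z`)
  have key := hflat L hL1 k c' (2 * Kb + 12) (by omega) Z hZsupp BZ hBZpos hcurlZ (2 * BZ) (by positivity) hcurlZ'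
    (flatDiv Z) (fun _ => 0) (fun xq => by simp) hgsupp Gb hdivZ 0 (fun xq lam => by simp) y₀ μ₀ κ₀
  have hP : ((L : ℝ) ^ (k + 1) * ((2 * Kb + 12 : ℕ) : ℝ)) * (2 * BZ) / BZ = 2 * ((L : ℝ) ^ (k + 1) * ((2 * Kb + 12 : ℕ) : ℝ)) := by
    field_simp
  rw [hP, mul_zero, add_zero] at key
  -- READ AT THE BOND: `Z(y₀+e_μ₀) − Z(y₀) = (V′ − V) − (1 − χ(y₀+e_μ₀))V′`
  set V := dirGauge u Y with hV
  have hread : ‖V (y₀ + e μ₀) κ₀ - V y₀ κ₀‖ ≤ ‖Z (y₀ + e μ₀) κ₀ - Z y₀ κ₀‖ + g₁ * S := by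
    have e1 : V (y₀ + e μ₀) κ₀ - V y₀ κ₀ = (Z (y₀ + e μ₀) κ₀ - Z y₀ κ₀) + (1 - χ (y₀ + e μ₀)) • V (y₀ + e μ₀) κ₀ := by
      simp only [hZ, hχy₀, one_smul, sub_smul]; abel
    rw [e1]
    refine (norm_add_le _ _).trans (add_le_add le_rfl ?_)
    rw [norm_smul, Real.norm_eq_abs]
    have hχd : |1 - χ (y₀ + e μ₀)| ≤ g₁ := by
      rw [← hχy₀, abs_sub_comm]
      exact hstep y₀ (y₀ + e μ₀) (fun j => by simp only [Pi.add_apply, e_apply]; split_ifs <;> simp)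
    exact mul_le_mul hχd (hS' _ _) (norm_nonneg _) hg₁0
  -- THE COVARIANT GRADIENT FROM THE PLAIN ONE (`W^{u}` is `δ`-flat at the bond `(y₀ + e_κ₀, μ₀)`)
  have hχ0 : χ y₀ ≠ 0 := by rw [hχy₀]; exact one_ne_zero
  have hδb : ‖((gaugeAct u W (y₀ + e κ₀) μ₀ : (Matrix n n ℂ)ˣ) : Matrix n n ℂ) - 1‖ ≤ δs :=
    hnear1 y₀ hχ0 (y₀ + e κ₀) (fun i => by simp only [Pi.add_apply, e_apply]; split_ifs <;> simp) μ₀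
  have hcov := norm_covDiff_le_fdiff_dirGauge hWu huu Y y₀ μ₀ κ₀ hδb
  have h2δ : 2 * δs * ‖Y (y₀ + e μ₀) κ₀‖ ≤ 2 * δs * S := mul_le_mul_of_nonneg_left (hS _ _) (by positivity)
  calc ‖Ad (W (y₀ + e κ₀) μ₀) (Y (y₀ + e μ₀) κ₀) - Y y₀ κ₀‖
      ≤ ‖V (y₀ + e μ₀) κ₀ - V y₀ κ₀‖ + 2 * δs * ‖Y (y₀ + e μ₀) κ₀‖ := hcov
    _ ≤ (‖Z (y₀ + e μ₀) κ₀ - Z y₀ κ₀‖ + g₁ * S) + 2 * δs * S := add_le_add hread h2δ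
    _ ≤ (K * (BZ * (1 + Real.posLog (2 * ((L : ℝ) ^ (k + 1) * ((2 * Kb + 12 : ℕ) : ℝ))))
          + (1 + Real.log ((L : ℝ) ^ (k + 1) * ((2 * Kb + 12 : ℕ) : ℝ))) * Gb) + g₁ * S) + 2 * δs * S := by linarith only [key]
    _ = _ := by rw [hBZ, hGb]; ring

end

end Summit.QuantumFields.BalabanUV.T4Continuum.NE7CurvedGradLetter
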